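import Summits.CriticalPhenomena.PercolationContinuityZ3.Theorems.Transplant.PlanarSkeletonFrmFromDefs
import Summits.CriticalPhenomena.PercolationContinuityZ3.Theorems.Transplant.SkelFrmFromBParamsCorrKGLenY
import Summits.CriticalPhenomena.PercolationContinuityZ3.Theorems.Transplant.SkelFrmBParamsCorrKGLenY
import HarnessLib
import Summits.CriticalPhenomena.PercolationContinuityZ3.Theorems.Transplant.SkelFrmBParamsCorrKGLen3
/-!
# U-WAVE PORT (RULING D-U, lead g21 2026-08-26; WAVE-U-MANIFEST v3.1 row «SkelFrmBParamsCorrKGLen3» ↦ «SkelFrmFromBParamsCorrKGLen3») of the tree module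
# `Transplant/SkelFrmBParamsCorrKGLen3` onto the carrier `PlanarSkeletonFrmFrom` (frames only, cylinders connected from width `ℓ₀` on)

ORIGINAL TITLE: N2 (frames-only node `SamePDropOfSkeletonFrmFrom₁`, OPEN) — (ζ″) ledger under J23/(R-44): THE CORRIDOR BUDGETS WITH HEADROOM FOR EVERY WINDOW OF RECORD UP TO

builds on p205010 (kernel theorem, internal audit signed; external expert review pending) — nothing in this file uses p205010; NOTHING is claimed about the
OPEN node U `SamePDropOfSkeletonFrmFrom₁` (nor U_s / the end state).  Lane `prim-bschramm`, seat `prim-bschramm-stmt` gen 26 (port pen, RULING M-11 family P-stmt; tool = p3-g26's port_u.py of record, registry-driven inputs); helper file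
(`--supports stmt-CriticalPhenomena-4575 --as helper`).  PORT RULES r1–r4 of RULING D-U: declaration order and proof texts are those of the original,
byte-identical except (i) the carrier token `PlanarSkeletonFrm ↦ PlanarSkeletonFrmFrom` (binders, `namespace`/`end` lines, qualified names of twinned
declarations), (ii) carrier-FREE declarations of the original (φ-level `Skelφ…` blocks and namespace-only arithmetic residents) are NOT re-declared —
this file imports the original and `export`s the twin-free residents (POLICY T / treatment (m1)); residents whose statement mentions a twinned
constant are copied, (iii) every carrier-binding declaration keeps its explicit binder `(Φ : PlanarSkeletonFrmFrom G)` in its own signature (r2).  Docstrings and citations are the original's.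
-/

open scoped Classical

noncomputable section

namespace Summit.CriticalPhenomena.PercolationContinuityZ3.Theorems.Transplant

namespace Skelφ

open Literature.Probability.Percolation Literature.Probability.LatticeModels SimpleGraph

section Budget3

variable {n ℓ : ℕ} {hs v : ℤ} {R' ρ q W : ℕ}

end Budget3

end Skelφ

/-! ## At the values of record (`ρ := 0`): the successor residual floors and the two budgets -/

namespace PlanarSkeletonFrmFrom

namespace NegB

open Literature.Probability.Percolation Literature.Probability.LatticeModels SimpleGraph
open SkelConc (Consts)
open Skelφ (shearUnit kgSL kgSLY kgM₁ kgM₂ kgM₁Y kgM₂Y KGRows KGYRows)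
open Neg

section Values3

variable (κ : Consts) {V : Type} [DecidableEq V] [Countable V] {G : SimpleGraph V} [G.LocallyFinite] (Φ : PlanarSkeletonFrmFrom G) (t : V) (p : unitInterval)
  (D : Skelφ.StepI.DataNS V) (g f mk qx Wx : ℕ)

/-- **The residual floors with headroom, first axis**: `qx ≤ 100·n_L`, `Wx ≤ 20·sL`. [this work] -/
structure KGRes3 : Prop where
  /-- `qx ≤ 100·n_L` -/
  hqx : qx ≤ 100 * nL κ Φ t p D g f
  /-- `Wx ≤ 20·sL` -/
  hWx : (Wx : ℤ) ≤ 20 * kgSL (nL κ Φ t p D g f) (ℓL κ Φ t p D g f) (hL κ Φ t p D g f)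

/-- **The residual floors with headroom, second axis**: `qx ≤ 40·sL` (rows), `Wx ≤ 100·n_L` (x′ units). [this work] -/
structure KGResY3 : Prop where
  /-- `qx ≤ 40·sL` -/
  hqx : (qx : ℤ) ≤ 40 * kgSLY (nL κ Φ t p D g f) (ℓL κ Φ t p D g f) (hL κ Φ t p D g f)
  /-- `Wx ≤ 100·n_L` -/
  hWx : Wx ≤ 100 * nL κ Φ t p D g f

/-- `KGRes3` keeps `KGRes`'s across cap, so `kg_floors` applies. [folklore] -/
theorem KGRes3.toWx (κ : Consts) {V : Type} [DecidableEq V] [Countable V] {G : SimpleGraph V} [G.LocallyFinite] (Φ : PlanarSkeletonFrmFrom G) (t : V) (p : unitInterval) (D : Skelφ.StepI.DataNS V) (g : ℕ) (f : ℕ) (qx : ℕ) (Wx : ℕ) (hx : KGRes3 κ Φ t p D g f qx Wx) : (Wx : ℤ) ≤ 20 * kgSL (nL κ Φ t p D g f) (ℓL κ Φ t p D g f) (hL κ Φ t p D g f) := hx.hWx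

/-- **THE CORRIDOR FITS THE BUDGET at the wider along window** (`ρ := 0`, `KGRes3`): `N + 1 + (m₁+1) + (m₂+1) ≤ LfQ κ.K₀`. [this work] -/
theorem kgSchedN_le_LfQ3 (κ : Consts) {V : Type} [DecidableEq V] [Countable V] {G : SimpleGraph V} [G.LocallyFinite] (Φ : PlanarSkeletonFrmFrom G) (t : V) (p : unitInterval) (D : Skelφ.StepI.DataNS V) (g : ℕ) (f : ℕ) (mk : ℕ) (qx : ℕ) (Wx : ℕ) (hN : EqNumL κ Φ t p D g f) (hg : gFloorKG κ Φ t p D mk ≤ g) (hx : KGRes3 κ Φ t p D g f qx Wx) :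
    kgNv0 κ Φ t p D g f mk qx Wx + 1 +
        (kgM₁ (nL κ Φ t p D g f) (ℓL κ Φ t p D g f) (hL κ Φ t p D g f) (kgR κ Φ t p D mk) 0 (kgW κ Φ t p D g f Wx)
          (kgNv0 κ Φ t p D g f mk qx Wx) + 1) +
        (kgM₂ (nL κ Φ t p D g f) (ℓL κ Φ t p D g f) (hL κ Φ t p D g f) (vL κ Φ t p D g f) (kgR κ Φ t p D mk) 0 (kgq κ Φ t p D g f qx)
          (kgW κ Φ t p D g f Wx) (kgNv0 κ Φ t p D g f mk qx Wx) + 1) ≤ LfQ κ.K₀ := by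
  have H := kgRows0_of κ Φ t p D g f mk qx Wx hN hg
  obtain ⟨hS, hSn, -, hR8, hW2⟩ := kg_floors κ Φ t p D g f mk Wx hN hg hx.hWx
  have hNle := kgNv0_le κ Φ t p D g f mk qx Wx hN hg
  have hK := (Skelφ.NegPrm.forty_le_Kcell κ.K₀).1
  have hK' : (40 : ℤ) ≤ (Neg.K κ : ℤ) := by unfold Neg.K; exact_mod_cast hK
  have hNz : ((kgNv0 κ Φ t p D g f mk qx Wx : ℕ) : ℤ) ≤ 20 * (Neg.K κ : ℤ) + 4 := by exact_mod_cast hNle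
  have hq6 : ((kgq κ Φ t p D g f qx : ℕ) : ℤ) ≤ 102 * (nL κ Φ t p D g f : ℤ) := by
    have hqx : qx ≤ 100 * nL κ Φ t p D g f := hx.hqx
    unfold kgq; push_cast
    have : ((qx : ℕ) : ℤ) ≤ 100 * (nL κ Φ t p D g f : ℤ) := by exact_mod_cast hqx
    linarith
  have hb := H.kgSchedN_budget3 hS hSn hR8 hW2 hq6 hK' (kgNv0 κ Φ t p D g f mk qx Wx) hNz
  have hZ : ((kgNv0 κ Φ t p D g f mk qx Wx + 1 +
        (kgM₁ (nL κ Φ t p D g f) (ℓL κ Φ t p D g f) (hL κ Φ t p D g f) (kgR κ Φ t p D mk) 0 (kgW κ Φ t p D g f Wx)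
          (kgNv0 κ Φ t p D g f mk qx Wx) + 1) +
        (kgM₂ (nL κ Φ t p D g f) (ℓL κ Φ t p D g f) (hL κ Φ t p D g f) (vL κ Φ t p D g f) (kgR κ Φ t p D mk) 0 (kgq κ Φ t p D g f qx)
          (kgW κ Φ t p D g f Wx) (kgNv0 κ Φ t p D g f mk qx Wx) + 1) : ℕ) : ℤ) ≤ ((LfQ κ.K₀ : ℕ) : ℤ) := by
    rw [LfQ_eq]; push_cast; linarith
  exact_mod_cast hZ

/-- **THE N-CORRIDOR FITS THE BUDGET at the wider across window** (`ρ := 0`, `KGResY3`): `N + 1 + (m₁+1) + (m₂+1) ≤ LfQ κ.K₀`. [this work] -/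
theorem kgSchedNY_le_LfQ3 (κ : Consts) {V : Type} [DecidableEq V] [Countable V] {G : SimpleGraph V} [G.LocallyFinite] (Φ : PlanarSkeletonFrmFrom G) (t : V) (p : unitInterval) (D : Skelφ.StepI.DataNS V) (g : ℕ) (f : ℕ) (mk : ℕ) (qx : ℕ) (Wx : ℕ) (hN : EqNumL κ Φ t p D g f) (hg : gFloorKG κ Φ t p D mk ≤ g) (hx : KGResY3 κ Φ t p D g f qx Wx) :
    kgNYv0 κ Φ t p D g f mk qx Wx + 1 +
        (kgM₁Y (nL κ Φ t p D g f) (vL κ Φ t p D g f) (kgR κ Φ t p D mk) 0 (kgWY κ Φ t p D g f Wx) (kgNYv0 κ Φ t p D g f mk qx Wx) + 1) +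
        (kgM₂Y (nL κ Φ t p D g f) (ℓL κ Φ t p D g f) (hL κ Φ t p D g f) (vL κ Φ t p D g f) (kgR κ Φ t p D mk) 0 (kgqY κ Φ t p D g f qx)
          (kgWY κ Φ t p D g f Wx) (kgNYv0 κ Φ t p D g f mk qx Wx) + 1) ≤ LfQ κ.K₀ := by
  have H := kgYRows0_of κ Φ t p D g f mk qx Wx hN hg
  obtain ⟨hSn, hS, hR8, hbig, hρP⟩ := kgY_floors κ Φ t p D g f mk hN hg
  have hNle := kgNYv0_le κ Φ t p D g f mk qx Wx hN hg
  have hK := (Skelφ.NegPrm.forty_le_Kcell κ.K₀).1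
  have hK' : (40 : ℤ) ≤ (Neg.K κ : ℤ) := by unfold Neg.K; exact_mod_cast hK
  have hNz : ((kgNYv0 κ Φ t p D g f mk qx Wx : ℕ) : ℤ) ≤ 21 * (Neg.K κ : ℤ) + 2 := by exact_mod_cast hNle
  have hW : ((kgWY κ Φ t p D g f Wx : ℕ) : ℤ) ≤ 102 * (nL κ Φ t p D g f : ℤ) := by
    have hWx : Wx ≤ 100 * nL κ Φ t p D g f := hx.hWx
    unfold kgWY; push_cast
    have : ((Wx : ℕ) : ℤ) ≤ 100 * (nL κ Φ t p D g f : ℤ) := by exact_mod_cast hWx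
    linarith
  have hq : ((kgqY κ Φ t p D g f qx : ℕ) : ℤ) ≤ 41 * kgSLY (nL κ Φ t p D g f) (ℓL κ Φ t p D g f) (hL κ Φ t p D g f) + 2 := by
    have hqx := hx.hqx
    have hPd := Skelφ.natDiv_le_kgSLY (one_le_of_eqNumL κ Φ t p D g f hN).1 (ℓL κ Φ t p D g f) (hL κ Φ t p D g f)
    unfold kgqY
    push_cast [Nat.cast_add] at hPd ⊢
    linarith
  have hb := H.kgSchedNY_budget3 hSn hS hR8 hW hq hρP hbig hK' (kgNYv0 κ Φ t p D g f mk qx Wx) hNz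
  have hZ : ((kgNYv0 κ Φ t p D g f mk qx Wx + 1 +
        (kgM₁Y (nL κ Φ t p D g f) (vL κ Φ t p D g f) (kgR κ Φ t p D mk) 0 (kgWY κ Φ t p D g f Wx) (kgNYv0 κ Φ t p D g f mk qx Wx) + 1) +
        (kgM₂Y (nL κ Φ t p D g f) (ℓL κ Φ t p D g f) (hL κ Φ t p D g f) (vL κ Φ t p D g f) (kgR κ Φ t p D mk) 0 (kgqY κ Φ t p D g f qx)
          (kgWY κ Φ t p D g f Wx) (kgNYv0 κ Φ t p D g f mk qx Wx) + 1) : ℕ) : ℤ) ≤ ((LfQ κ.K₀ : ℕ) : ℤ) := by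
    rw [LfQ_eq]; push_cast; linarith
  exact_mod_cast hZ

end Values3

end NegB

end PlanarSkeletonFrmFrom

end Summit.CriticalPhenomena.PercolationContinuityZ3.Theorems.Transplant

end
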